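import Literature.NumberTheory.Automorphic.SphericalCharactersSL2
import Literature.NumberTheory.Automorphic.UnramifiedCharactersInertPlaces
import Mathlib.LinearAlgebra.Eigenspace.Triangularizable
import Mathlib.LinearAlgebra.Eigenspace.Minpoly
import HarnessLib

/-!
# Every finite-dimensional Hecke module has a Hecke eigenvector, and Hecke eigenvectors have Satake parameters:
# `U(3)`, `U(2)` (`σ ≠ id`) and `SL₂`, locally and at the places of a number field
# (Cartier §IV Cor. 4.2; Rogawski §4.5)

Topic `NumberTheory/Automorphic`; namespaces `Literature.NumberTheory.Automorphic[.HermitianLattice.UnramifiedLocalConjDatum |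
.SymplecticCartan | .UnitaryGroup]` (lane `lit-hodgefound`, Track 2 foundations; seat `lit-hodgefound-p11`, generation 47,
row g47-#13).  THEOREMS ONLY: no definition, no named fact, no instance, no notation.  Sequel of `SphericalCharactersSL2`
(g47-#9), `UnramifiedCharactersInertPlaces` (g47-#10) and `UnitaryRankOneUnramifiedCharacters` (g46-#5).

## The mathematics

Let `ℋ` be one of the rank-one spherical Hecke algebras `ℋ(U(3), K₀; ℂ)`, `ℋ(U(2), K₀; ℂ)` (`σ ≠ id`), `ℋ(SL₂(K), SL₂(𝒪); ℂ)`,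
and `ρ : ℋ → End_ℂ(V)` a representation on a finite-dimensional complex vector space `V ≠ 0` (e.g. a Hecke module cut out
of the cohomology of a Picard modular surface).  **(1)** Since `ℋ = ℂ[T₁]` is generated by one operator (g46-#5 / g46
`SymplecticRankOneBasicHeckeOperator`), an eigenvector `v` of `ρ(T₁)` (which exists, `ℂ` algebraically closed) is a
SIMULTANEOUS eigenvector: `ρ(T) v = ψ(T) v` for all `T`, and `T ↦ ψ(T)` is a `ℂ`-algebra character of `ℋ`
(`exists_algHom_of_forall_exists_smul`, `exists_eigenvector_of_generator`).  **(2)** By Cartier's Corollary 4.2 (g46-#5,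
g47-#9) every character is an unramified eigencharacter: **there are `v ≠ 0` and a torus parameter `β` with
`ρ(T) v = λ_β(T) v` for every Hecke operator `T`**, and conversely **every simultaneous Hecke eigenvector has an
eigencharacter of the form `λ_β`** — Hecke eigenclasses have Satake parameters (unique up to `z ↦ z⁻¹`, g47-#8).  The same at
every inert unramified place of a quadratic extension of number fields (g47-#10) and at every finite place for `SL₂`.

## What is formalised (theorems only)

* §1 (abstract, `A` any `ℂ`-algebra) **`exists_algHom_of_forall_exists_smul`** (the eigen-scalars of a simultaneous eigenvector
  form an algebra character), **`exists_eigenvector_of_generator`** (`A = ℂ[T₁]` ⟹ a common eigenvector exists).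
* §2 (`U(3)`, `U(2)`, local) **`exists_eigenvector_heckeEigencharacter_three/two`**, **`exists_heckeEigencharacter_of_forall_smul_three/two`**.
* §3 (`SL₂`, local and at places) **`exists_eigenvector_symplecticHeckeEigencharacter_rank_one`**,
  `exists_symplecticHeckeEigencharacter_of_forall_smul_rank_one`, `exists_eigenvector_symplecticHeckeEigencharacterAdic_rank_one`,
  `exists_symplecticHeckeEigencharacterAdic_of_forall_smul_rank_one`.
* §4 (`U(3)`, `U(2)` at inert unramified places) `exists_eigenvector_unitaryHeckeEigencharacterAdic_three/two`,
  `exists_unitaryHeckeEigencharacterAdic_of_forall_smul_three/two`.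

## References
* [CartierCorvallis1979] P. Cartier, *Representations of 𝔭-adic groups: a survey*, PSPM 33.1 (1979), §IV Thm. 4.1, Cor. 4.2.
* [Rogawski1990] J. D. Rogawski, *Automorphic Representations of Unitary Groups in Three Variables* (1990), §4.5 p. 50.
* [Macdonald1995] I. G. Macdonald, *Symmetric Functions and Hall Polynomials*, 2nd ed. (1995), Ch. V (3.4).
-/

noncomputable section

open scoped Valued WithZero Matrix MatrixGroups
open Matrix MonoidAlgebra Representation NumberField IsDedekindDomain Polynomial

/-! ## §1 Simultaneous eigenvectors of a one-generator algebra -/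

namespace Literature.NumberTheory.Automorphic

/-- **The eigen-scalars of a simultaneous eigenvector form an algebra character**: if `v ≠ 0` and every `ρ(T)` scales `v`,
then `ρ(T) v = ψ(T) v` for a (unique) `ℂ`-algebra homomorphism `ψ : A → ℂ`. [cite: CartierCorvallis1979, §IV Cor. 4.2] -/
theorem exists_algHom_of_forall_exists_smul {A V : Type*} [Semiring A] [Algebra ℂ A] [AddCommGroup V] [Module ℂ V]
    (ρ : A →ₐ[ℂ] Module.End ℂ V) {v : V} (hv : v ≠ 0) (h : ∀ T, ∃ c : ℂ, ρ T v = c • v) :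
    ∃ ψ : A →ₐ[ℂ] ℂ, ∀ T, ρ T v = ψ T • v := by
  choose c hc using h
  have hinj : Function.Injective fun a : ℂ => a • v := smul_left_injective ℂ hv
  have h1 : c 1 = 1 := hinj (by simp only; rw [← hc, map_one, Module.End.one_apply, one_smul])
  have hmul : ∀ S T, c (S * T) = c S * c T := fun S T =>
    hinj (by simp only; rw [← hc, map_mul, Module.End.mul_apply, hc T, map_smul, hc S, smul_smul, mul_comm])
  have h0 : c 0 = 0 := hinj (by simp only; rw [← hc, map_zero, LinearMap.zero_apply, zero_smul])
  have hadd : ∀ S T, c (S + T) = c S + c T := fun S T =>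
    hinj (by simp only; rw [← hc, map_add, LinearMap.add_apply, hc S, hc T, add_smul])
  have hcomm : ∀ r : ℂ, c (algebraMap ℂ A r) = r := fun r =>
    hinj (by simp only; rw [← hc, AlgHom.commutes, Module.algebraMap_end_apply])
  exact ⟨⟨⟨⟨⟨c, h1⟩, hmul⟩, h0, hadd⟩, hcomm⟩, hc⟩

/-- **A one-generator `ℂ`-algebra acting on a non-zero finite-dimensional space has a simultaneous eigenvector** with an
algebra character as eigen-scalars: an eigenvector of `ρ(T₁)` works, as every `T` is a polynomial in `T₁`.
[cite: CartierCorvallis1979, §IV Thm. 4.1, Cor. 4.2] -/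
theorem exists_eigenvector_of_generator {A V : Type*} [Semiring A] [Algebra ℂ A] [AddCommGroup V] [Module ℂ V]
    [FiniteDimensional ℂ V] [Nontrivial V] (ρ : A →ₐ[ℂ] Module.End ℂ V) {T₁ : A} (hgen : ∀ T, ∃ P : ℂ[X], aeval T₁ P = T) :
    ∃ v : V, v ≠ 0 ∧ ∃ ψ : A →ₐ[ℂ] ℂ, ∀ T, ρ T v = ψ T • v := by
  obtain ⟨t, ht⟩ := Module.End.exists_eigenvalue (ρ T₁)
  obtain ⟨v, hv⟩ := ht.exists_hasEigenvector
  refine ⟨v, hv.2, exists_algHom_of_forall_exists_smul ρ hv.2 fun T => ?_⟩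
  obtain ⟨P, rfl⟩ := hgen T
  exact ⟨P.eval t, by rw [← Polynomial.aeval_algHom_apply, Module.End.aeval_apply_of_hasEigenvector hv]⟩

end Literature.NumberTheory.Automorphic

/-! ## §2 `U(3)` and `U(2)` (`σ ≠ id`): Hecke eigenvectors and their Satake parameters -/

namespace Literature.NumberTheory.Automorphic.HermitianLattice.UnramifiedLocalConjDatum

open Literature.NumberTheory.Automorphic.CartanUnique Literature.NumberTheory.Automorphic.SymplecticCartan
  Literature.NumberTheory.Automorphic

variable {K : Type*} [Field K] [Valued K ℤᵐ⁰] {σ : K →+* K} {ϖ : K} [Finite 𝓀[K]]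
  {V : Type*} [AddCommGroup V] [Module ℂ V]

section Three

variable [IsHeckeTriple (⊤ : Submonoid (unitaryGroupOfForm σ ((StdForm.antidiagonal 3).over K)))
    (unitaryInt σ ((StdForm.antidiagonal 3).over K)) (unitaryInt σ ((StdForm.antidiagonal 3).over K))]

/-- **EVERY SIMULTANEOUS HECKE EIGENVECTOR FOR `U(3)` HAS SATAKE PARAMETERS**: if `v ≠ 0` is scaled by every `ρ(T)`, then
`ρ(T) v = λ_β(T) v` for some torus parameter `β ∈ (ℂˣ)³` (`σ ≠ id`). [cite: CartierCorvallis1979, §IV Cor. 4.2]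
[cite: Rogawski1990, §4.5 p. 50] -/
theorem exists_heckeEigencharacter_of_forall_smul_three (hd : UnramifiedLocalConjDatum σ ϖ) (hσ : ∃ x : K, σ x ≠ x)
    (ρ : heckeAlgebra ℂ (unitaryGroupOfForm σ ((StdForm.antidiagonal 3).over K)) (unitaryInt σ ((StdForm.antidiagonal 3).over K)) →ₐ[ℂ]
      Module.End ℂ V) {v : V} (hv : v ≠ 0) (h : ∀ T, ∃ c : ℂ, ρ T v = c • v) :
    ∃ β : Fin 3 → ℂˣ, ∀ T, ρ T v = hd.heckeEigencharacter β T • v := by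
  obtain ⟨ψ, hψ⟩ := exists_algHom_of_forall_exists_smul ρ hv h
  obtain ⟨β, hβ⟩ := hd.exists_heckeEigencharacter_eq_three hσ ψ
  exact ⟨β, fun T => by rw [hψ, hβ]⟩

/-- **EVERY NON-ZERO FINITE-DIMENSIONAL `ℋ(U(3), K₀; ℂ)`-MODULE HAS A HECKE EIGENVECTOR WITH SATAKE PARAMETERS**: there are
`v ≠ 0` and `β ∈ (ℂˣ)³` with `ρ(T) v = λ_β(T) v` for every Hecke operator `T` (`σ ≠ id`). [cite: CartierCorvallis1979, §IV Thm. 4.1, Cor. 4.2]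
[cite: Rogawski1990, §4.5 p. 50] -/
theorem exists_eigenvector_heckeEigencharacter_three [FiniteDimensional ℂ V] [Nontrivial V] (hd : UnramifiedLocalConjDatum σ ϖ)
    (hσ : ∃ x : K, σ x ≠ x)
    (ρ : heckeAlgebra ℂ (unitaryGroupOfForm σ ((StdForm.antidiagonal 3).over K)) (unitaryInt σ ((StdForm.antidiagonal 3).over K)) →ₐ[ℂ]
      Module.End ℂ V) :
    ∃ v : V, v ≠ 0 ∧ ∃ β : Fin 3 → ℂˣ, ∀ T, ρ T v = hd.heckeEigencharacter β T • v := by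
  obtain ⟨T₁, -, hgen⟩ := hd.exists_generator_three hσ
  obtain ⟨v, hv, ψ, hψ⟩ := exists_eigenvector_of_generator ρ hgen
  exact ⟨v, hv, hd.exists_heckeEigencharacter_of_forall_smul_three hσ ρ hv fun T => ⟨ψ T, hψ T⟩⟩

end Three

section Two

variable [IsHeckeTriple (⊤ : Submonoid (unitaryGroupOfForm σ ((StdForm.antidiagonal 2).over K)))
    (unitaryInt σ ((StdForm.antidiagonal 2).over K)) (unitaryInt σ ((StdForm.antidiagonal 2).over K))]

/-- **Every simultaneous Hecke eigenvector for `U(2)` has Satake parameters** (`σ ≠ id`). [cite: CartierCorvallis1979, §IV Cor. 4.2]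
[cite: Rogawski1990, §4.5 p. 50] -/
theorem exists_heckeEigencharacter_of_forall_smul_two (hd : UnramifiedLocalConjDatum σ ϖ) (hσ : ∃ x : K, σ x ≠ x)
    (ρ : heckeAlgebra ℂ (unitaryGroupOfForm σ ((StdForm.antidiagonal 2).over K)) (unitaryInt σ ((StdForm.antidiagonal 2).over K)) →ₐ[ℂ]
      Module.End ℂ V) {v : V} (hv : v ≠ 0) (h : ∀ T, ∃ c : ℂ, ρ T v = c • v) :
    ∃ β : Fin 2 → ℂˣ, ∀ T, ρ T v = hd.heckeEigencharacter β T • v := by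
  obtain ⟨ψ, hψ⟩ := exists_algHom_of_forall_exists_smul ρ hv h
  obtain ⟨β, hβ⟩ := hd.exists_heckeEigencharacter_eq_two hσ ψ
  exact ⟨β, fun T => by rw [hψ, hβ]⟩

/-- **Every non-zero finite-dimensional `ℋ(U(2), K₀; ℂ)`-module has a Hecke eigenvector with Satake parameters** (`σ ≠ id`).
[cite: CartierCorvallis1979, §IV Thm. 4.1, Cor. 4.2] [cite: Rogawski1990, §4.5 p. 50] -/
theorem exists_eigenvector_heckeEigencharacter_two [FiniteDimensional ℂ V] [Nontrivial V] (hd : UnramifiedLocalConjDatum σ ϖ)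
    (hσ : ∃ x : K, σ x ≠ x)
    (ρ : heckeAlgebra ℂ (unitaryGroupOfForm σ ((StdForm.antidiagonal 2).over K)) (unitaryInt σ ((StdForm.antidiagonal 2).over K)) →ₐ[ℂ]
      Module.End ℂ V) :
    ∃ v : V, v ≠ 0 ∧ ∃ β : Fin 2 → ℂˣ, ∀ T, ρ T v = hd.heckeEigencharacter β T • v := by
  obtain ⟨T₁, -, hgen⟩ := hd.exists_generator_two hσ
  obtain ⟨v, hv, ψ, hψ⟩ := exists_eigenvector_of_generator ρ hgen
  exact ⟨v, hv, hd.exists_heckeEigencharacter_of_forall_smul_two hσ ρ hv fun T => ⟨ψ T, hψ T⟩⟩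

end Two

end Literature.NumberTheory.Automorphic.HermitianLattice.UnramifiedLocalConjDatum

/-! ## §3 `SL₂(K)` and `SL₂(F_v)` -/

namespace Literature.NumberTheory.Automorphic.SymplecticCartan

open Literature.NumberTheory.Automorphic.CartanUnique Literature.NumberTheory.Automorphic

section Local

variable {K : Type*} [Field K] [Valued K ℤᵐ⁰] {ϖ : K} (hϖ : Valued.v ϖ = WithZero.exp (-1 : ℤ)) [Finite 𝓀[K]]
  [IsHeckeTriple (⊤ : Submonoid (symplecticGroup (Fin 1) K)) (symplecticInt (Fin 1) K) (symplecticInt (Fin 1) K)]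
  {V : Type*} [AddCommGroup V] [Module ℂ V]
include hϖ

/-- **Every simultaneous Hecke eigenvector for `SL₂(K)` has a Satake parameter**: `ρ(T) v = λ_{χ_z}(T) v` for some `z ∈ ℂˣ`
(`q ∈ ℂˣ` the residue cardinality). [cite: CartierCorvallis1979, §IV Cor. 4.2] [cite: Macdonald1995, Ch. V (3.4)] -/
theorem exists_symplecticHeckeEigencharacter_of_forall_smul_rank_one (q : ℂˣ) (hq : (q : ℂ) = Nat.card 𝓀[K])
    (ρ : heckeAlgebra ℂ (symplecticGroup (Fin 1) K) (symplecticInt (Fin 1) K) →ₐ[ℂ] Module.End ℂ V) {v : V} (hv : v ≠ 0)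
    (h : ∀ T, ∃ c : ℂ, ρ T v = c • v) :
    ∃ z : ℂˣ, ∀ T, ρ T v = symplecticHeckeEigencharacter hϖ q (laurentMonomialHom fun _ : Fin 1 => z) T • v := by
  obtain ⟨ψ, hψ⟩ := exists_algHom_of_forall_exists_smul ρ hv h
  obtain ⟨z, hz⟩ := exists_eq_symplecticHeckeEigencharacter_laurent_rank_one hϖ q hq ψ
  exact ⟨z, fun T => by rw [hψ, hz]⟩

/-- **Every non-zero finite-dimensional `ℋ(SL₂(K), SL₂(𝒪); ℂ)`-module has a Hecke eigenvector with a Satake parameter.**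
[cite: CartierCorvallis1979, §IV Thm. 4.1, Cor. 4.2] [cite: Macdonald1995, Ch. V (3.4)] -/
theorem exists_eigenvector_symplecticHeckeEigencharacter_rank_one [FiniteDimensional ℂ V] [Nontrivial V] (q : ℂˣ)
    (hq : (q : ℂ) = Nat.card 𝓀[K])
    (ρ : heckeAlgebra ℂ (symplecticGroup (Fin 1) K) (symplecticInt (Fin 1) K) →ₐ[ℂ] Module.End ℂ V) :
    ∃ v : V, v ≠ 0 ∧ ∃ z : ℂˣ, ∀ T, ρ T v = symplecticHeckeEigencharacter hϖ q (laurentMonomialHom fun _ : Fin 1 => z) T • v := by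
  obtain ⟨T₁, -, hgen⟩ := exists_generator_symplectic_rank_one hϖ q hq
  obtain ⟨v, hv, ψ, hψ⟩ := exists_eigenvector_of_generator ρ hgen
  exact ⟨v, hv, exists_symplecticHeckeEigencharacter_of_forall_smul_rank_one hϖ q hq ρ hv fun T => ⟨ψ T, hψ T⟩⟩

end Local

section NumberField

variable (F : Type*) [Field F] [NumberField F] (v : HeightOneSpectrum (𝓞 F)) {V : Type*} [AddCommGroup V] [Module ℂ V]

/-- **At every finite place `v`: every simultaneous Hecke eigenvector for `SL₂(F_v)` has a Satake parameter.**
[cite: CartierCorvallis1979, §IV Cor. 4.2] -/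
theorem exists_symplecticHeckeEigencharacterAdic_of_forall_smul_rank_one
    (ρ : heckeAlgebra ℂ (symplecticGroup (Fin 1) (v.adicCompletion F)) (symplecticInt (Fin 1) (v.adicCompletion F)) →ₐ[ℂ]
      Module.End ℂ V) {x : V} (hx : x ≠ 0) (h : ∀ T, ∃ c : ℂ, ρ T x = c • x) :
    ∃ z : ℂˣ, ∀ T, ρ T x = symplecticHeckeEigencharacterAdic F v (laurentMonomialHom fun _ : Fin 1 => z) T • x := by
  obtain ⟨ψ, hψ⟩ := exists_algHom_of_forall_exists_smul ρ hx h
  obtain ⟨z, hz⟩ := exists_eq_symplecticHeckeEigencharacterAdic_rank_one F v ψ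
  exact ⟨z, fun T => by rw [hψ, hz]⟩

/-- **At every finite place `v`: every non-zero finite-dimensional `ℋ(SL₂(F_v), SL₂(𝒪_v); ℂ)`-module has a Hecke eigenvector
with a Satake parameter.** [cite: CartierCorvallis1979, §IV Thm. 4.1, Cor. 4.2] -/
theorem exists_eigenvector_symplecticHeckeEigencharacterAdic_rank_one [FiniteDimensional ℂ V] [Nontrivial V]
    (ρ : heckeAlgebra ℂ (symplecticGroup (Fin 1) (v.adicCompletion F)) (symplecticInt (Fin 1) (v.adicCompletion F)) →ₐ[ℂ]
      Module.End ℂ V) :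
    ∃ x : V, x ≠ 0 ∧ ∃ z : ℂˣ, ∀ T, ρ T x = symplecticHeckeEigencharacterAdic F v (laurentMonomialHom fun _ : Fin 1 => z) T • x := by
  haveI := finite_residueField_adicCompletion F v
  haveI := isHeckeTriple_symplecticInt_adicCompletion F v (l := Fin 1)
  obtain ⟨T₁, -, hgen⟩ := exists_generator_symplectic_rank_one (v_adicUniformizer F v) (residueNormUnit F v)
    (coe_residueNormUnit_eq_natCard F v)
  obtain ⟨x, hx, ψ, hψ⟩ := exists_eigenvector_of_generator ρ hgen
  exact ⟨x, hx, exists_symplecticHeckeEigencharacterAdic_of_forall_smul_rank_one F v ρ hx fun T => ⟨ψ T, hψ T⟩⟩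

end NumberField

end Literature.NumberTheory.Automorphic.SymplecticCartan

/-! ## §4 `U(3)(E_w)`, `U(2)(E_w)` at the inert unramified places of a quadratic extension of number fields -/

namespace Literature.NumberTheory.Automorphic.UnitaryGroup

open Literature.NumberTheory.Automorphic.HermitianLattice Literature.NumberTheory.Automorphic

variable {F E : Type} [Field F] [NumberField F] [Field E] [NumberField E] [Algebra F E] [Algebra.IsQuadraticExtension F E]
  (c : E ≃ₐ[F] E) (hc1 : c ≠ 1) (v : HeightOneSpectrum (𝓞 F)) (w : PlacesOver E v) (hw : c • w.1 = w.1)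
  (hv : Algebra.IsUnramifiedIn (𝓞 E) v.asIdeal) {V : Type*} [AddCommGroup V] [Module ℂ V]

set_option maxHeartbeats 400000 in
/-- **At every inert unramified place: every simultaneous Hecke eigenvector for `U(3)(E_w)` has Satake parameters.**
[cite: CartierCorvallis1979, §IV Cor. 4.2] [cite: Rogawski1990, §4.5 p. 50] -/
theorem exists_unitaryHeckeEigencharacterAdic_of_forall_smul_three
    (ρ : heckeAlgebra ℂ (unitaryGroupOfForm (galAdicCompletionMap (L := E) c hw) ((StdForm.antidiagonal 3).over (w.1.adicCompletion E)))
      (unitaryInt (galAdicCompletionMap (L := E) c hw) ((StdForm.antidiagonal 3).over (w.1.adicCompletion E))) →ₐ[ℂ] Module.End ℂ V)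
    {x : V} (hx : x ≠ 0) (h : ∀ T, ∃ a : ℂ, ρ T x = a • x) :
    ∃ β : Fin 3 → ℂˣ, ∀ T, ρ T x = unitaryHeckeEigencharacterAdic c hc1 v w hw hv β T • x := by
  obtain ⟨ψ, hψ⟩ := exists_algHom_of_forall_exists_smul ρ hx h
  obtain ⟨β, hβ⟩ := exists_eq_unitaryHeckeEigencharacterAdic_three c hc1 v w hw hv ψ
  exact ⟨β, fun T => by rw [hψ, hβ]⟩

/-- **At every inert unramified place: every non-zero finite-dimensional `ℋ(U(3)(E_w), K₀; ℂ)`-module has a Hecke eigenvector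
with Satake parameters.** [cite: CartierCorvallis1979, §IV Thm. 4.1, Cor. 4.2] [cite: Rogawski1990, §4.5 p. 50] -/
theorem exists_eigenvector_unitaryHeckeEigencharacterAdic_three [FiniteDimensional ℂ V] [Nontrivial V]
    (ρ : heckeAlgebra ℂ (unitaryGroupOfForm (galAdicCompletionMap (L := E) c hw) ((StdForm.antidiagonal 3).over (w.1.adicCompletion E)))
      (unitaryInt (galAdicCompletionMap (L := E) c hw) ((StdForm.antidiagonal 3).over (w.1.adicCompletion E))) →ₐ[ℂ] Module.End ℂ V) :
    ∃ x : V, x ≠ 0 ∧ ∃ β : Fin 3 → ℂˣ, ∀ T, ρ T x = unitaryHeckeEigencharacterAdic c hc1 v w hw hv β T • x := by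
  obtain ⟨T₁, hgen⟩ := exists_generator_unitaryHeckeAlgebraAdic_three c hc1 v w hw hv
  obtain ⟨x, hx, ψ, hψ⟩ := exists_eigenvector_of_generator ρ hgen
  exact ⟨x, hx, exists_unitaryHeckeEigencharacterAdic_of_forall_smul_three c hc1 v w hw hv ρ hx fun T => ⟨ψ T, hψ T⟩⟩

set_option maxHeartbeats 400000 in
/-- **At every inert unramified place: every simultaneous Hecke eigenvector for `U(2)(E_w)` has Satake parameters.**
[cite: CartierCorvallis1979, §IV Cor. 4.2] [cite: Rogawski1990, §4.5 p. 50] -/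
theorem exists_unitaryHeckeEigencharacterAdic_of_forall_smul_two
    (ρ : heckeAlgebra ℂ (unitaryGroupOfForm (galAdicCompletionMap (L := E) c hw) ((StdForm.antidiagonal 2).over (w.1.adicCompletion E)))
      (unitaryInt (galAdicCompletionMap (L := E) c hw) ((StdForm.antidiagonal 2).over (w.1.adicCompletion E))) →ₐ[ℂ] Module.End ℂ V)
    {x : V} (hx : x ≠ 0) (h : ∀ T, ∃ a : ℂ, ρ T x = a • x) :
    ∃ β : Fin 2 → ℂˣ, ∀ T, ρ T x = unitaryHeckeEigencharacterAdic c hc1 v w hw hv β T • x := by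
  obtain ⟨ψ, hψ⟩ := exists_algHom_of_forall_exists_smul ρ hx h
  obtain ⟨β, hβ⟩ := exists_eq_unitaryHeckeEigencharacterAdic_two c hc1 v w hw hv ψ
  exact ⟨β, fun T => by rw [hψ, hβ]⟩

/-- **At every inert unramified place: every non-zero finite-dimensional `ℋ(U(2)(E_w), K₀; ℂ)`-module has a Hecke eigenvector
with Satake parameters.** [cite: CartierCorvallis1979, §IV Thm. 4.1, Cor. 4.2] [cite: Rogawski1990, §4.5 p. 50] -/
theorem exists_eigenvector_unitaryHeckeEigencharacterAdic_two [FiniteDimensional ℂ V] [Nontrivial V]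
    (ρ : heckeAlgebra ℂ (unitaryGroupOfForm (galAdicCompletionMap (L := E) c hw) ((StdForm.antidiagonal 2).over (w.1.adicCompletion E)))
      (unitaryInt (galAdicCompletionMap (L := E) c hw) ((StdForm.antidiagonal 2).over (w.1.adicCompletion E))) →ₐ[ℂ] Module.End ℂ V) :
    ∃ x : V, x ≠ 0 ∧ ∃ β : Fin 2 → ℂˣ, ∀ T, ρ T x = unitaryHeckeEigencharacterAdic c hc1 v w hw hv β T • x := by
  obtain ⟨T₁, hgen⟩ := exists_generator_unitaryHeckeAlgebraAdic_two c hc1 v w hw hv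
  obtain ⟨x, hx, ψ, hψ⟩ := exists_eigenvector_of_generator ρ hgen
  exact ⟨x, hx, exists_unitaryHeckeEigencharacterAdic_of_forall_smul_two c hc1 v w hw hv ρ hx fun T => ⟨ψ T, hψ T⟩⟩

end Literature.NumberTheory.Automorphic.UnitaryGroup
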